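import Literature.Computability.Cryptography.PeriodFindingShiftCell
import Literature.Computability.Cryptography.PeriodFindingBoxPoisson
import HarnessLib

/-!
# Shifted Dirichlet kernels on the `1/M` grid: exact energy and window tails

Topic `Computability/Cryptography` (harmonic analysis of period finding); theorem-only file, no named facts.

The one-dimensional kernel `D_M(y) = ∑_{m<M} e(y m)` sampled at the `M` points `y = x + ν/M` of a shifted grid:

* `sum_norm_sq_kernel_shift` — the EXACT energy `∑_{ν<M} |D_M(x + ν/M)|² = M²` for every real shift `x` (Parseval on `ℤ/M`
  with a twist); this is what makes nested digit sums factorise level by level;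
* `norm_kernel_le` — `|D_M(y)| ≤ 1/(2‖y‖)` (`‖y‖` the distance to `ℤ`, written with `Int.fract`);
* `sum_norm_sq_kernel_shift_offWindow` — the energy outside the window of `u` grid points around the peak is
  `≤ M²/(u − 2)`: a measured digit lies within `u` grid steps of its peak except with probability `≤ 1/(u − 2)`.

## References

* P. W. Shor, SIAM J. Comput. 26 (1997), §5. [Shor1997]
* A. Yu. Kitaev, arXiv:quant-ph/9511026 (1995), §4. [Kitaev1995]
-/

noncomputable section

namespace Literature.Computability.Cryptography

namespace PeriodFinding

open Complex Finset Real

/-! ### The twisted Parseval identity -/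

/-- `e(y m) conj e(y m') = e(x (m − m')) · chr M ν (m − m')` at `y = x + ν/M`. [folklore] -/
theorem e1_mul_conj_e1_shift (M : ℕ) (hM : 0 < M) (x : ℝ) (ν m m' : ℕ) :
    e1 (x + ν / M) m * (starRingEnd ℂ) (e1 (x + ν / M) m') =
      cexp (2 * Real.pi * I * ((x * ((m : ℝ) - m') : ℝ) : ℂ)) * chr M ν ((m : ℤ) - m') := by
  have hM' : (M : ℂ) ≠ 0 := by exact_mod_cast hM.ne'
  unfold e1
  rw [← Complex.exp_conj, ← Complex.exp_add, chr_def, ← Complex.exp_add]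
  congr 1
  simp only [map_mul, Complex.conj_ofReal, Complex.conj_I, map_ofNat]
  push_cast
  field_simp
  ring

/-- **Twisted Parseval on `ℤ/M`**: `∑_{ν<M} |∑_{m<M} e((x + ν/M) m)|² = M²` for every real `x`. [folklore] -/
theorem sum_norm_sq_kernel_shift (M : ℕ) (hM : 0 < M) (x : ℝ) :
    ∑ ν ∈ range M, ‖∑ m ∈ range M, e1 (x + ν / M) m‖ ^ 2 = (M : ℝ) ^ 2 := by
  apply Complex.ofReal_injective
  push_cast
  have hexp : ∀ ν ∈ range M, (((‖∑ m ∈ range M, e1 (x + ν / M) m‖ : ℝ) : ℂ) ^ 2) =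
      ∑ m ∈ range M, ∑ m' ∈ range M,
        cexp (2 * Real.pi * I * ((x * ((m : ℝ) - m') : ℝ) : ℂ)) * chr M ν ((m : ℤ) - m') := by
    intro ν _
    rw [cast_norm_sq_sum]
    exact sum_congr rfl fun m _ => sum_congr rfl fun m' _ => e1_mul_conj_e1_shift M hM x ν m m'
  rw [sum_congr rfl hexp, sum_comm]
  -- `∑_ν chr M ν (m − m') = M [m = m']`
  have hinner : ∀ m ∈ range M, (∑ ν ∈ range M, ∑ m' ∈ range M,
      cexp (2 * Real.pi * I * ((x * ((m : ℝ) - m') : ℝ) : ℂ)) * chr M ν ((m : ℤ) - m')) = M := by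
    intro m hm
    rw [sum_comm]
    have : ∀ m' ∈ range M, (∑ ν ∈ range M, cexp (2 * Real.pi * I * ((x * ((m : ℝ) - m') : ℝ) : ℂ)) *
        chr M ν ((m : ℤ) - m')) = if m' = m then (M : ℂ) else 0 := by
      intro m' hm'
      rw [← mul_sum, sum_chr M hM]
      by_cases h : m' = m
      · subst h; simp
      · rw [if_neg (fun hd => h ((dvd_sub_iff_eq (mem_range.1 hm) (mem_range.1 hm')).1 hd)), if_neg h, mul_zero]
    rw [sum_congr rfl this, sum_ite_eq' (range M) m, if_pos hm]
  rw [sum_congr rfl hinner, sum_const, card_range, nsmul_eq_mul]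
  ring

/-! ### The kernel bound through the distance to `ℤ` -/

/-- The kernel only depends on `y mod 1`. [folklore] -/
theorem kernel_add_int (M : ℕ) (y : ℝ) (n : ℤ) :
    ∑ m ∈ range M, e1 (y + n) m = ∑ m ∈ range M, e1 y m := by
  refine sum_congr rfl fun m _ => ?_
  unfold e1
  rw [show ((((y + n) * (m : ℝ)) : ℝ) : ℂ) = (((y * m : ℝ) : ℂ)) + ((n * m : ℤ) : ℂ) by push_cast; ring,
    mul_add, Complex.exp_add, show 2 * (Real.pi : ℂ) * I * ((n * m : ℤ) : ℂ) = ((n * m : ℤ) : ℂ) * (2 * Real.pi * I) by ring,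
    Complex.exp_int_mul_two_pi_mul_I, mul_one]

/-- `2 min(f, 1 − f) ≤ |sin(π f)|` for `f ∈ [0, 1]` (Jordan). [folklore] -/
theorem two_mul_min_le_abs_sin {f : ℝ} (h0 : 0 ≤ f) (h1 : f ≤ 1) :
    2 * min f (1 - f) ≤ |Real.sin (Real.pi * f)| := by
  rcases le_or_gt f (1 / 2) with h | h
  · rw [min_eq_left (by linarith)]
    have hj := Real.mul_le_sin (x := Real.pi * f) (by positivity) (by nlinarith [Real.pi_pos])
    calc 2 * f = 2 / Real.pi * (Real.pi * f) := by field_simp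
      _ ≤ Real.sin (Real.pi * f) := hj
      _ ≤ |Real.sin (Real.pi * f)| := le_abs_self _
  · rw [min_eq_right (by linarith)]
    have hj := Real.mul_le_sin (x := Real.pi * (1 - f)) (by nlinarith [Real.pi_pos]) (by nlinarith [Real.pi_pos])
    calc 2 * (1 - f) = 2 / Real.pi * (Real.pi * (1 - f)) := by field_simp
      _ ≤ Real.sin (Real.pi * (1 - f)) := hj
      _ = Real.sin (Real.pi * f) := by rw [show Real.pi * (1 - f) = Real.pi - Real.pi * f by ring, Real.sin_pi_sub]
      _ ≤ |Real.sin (Real.pi * f)| := le_abs_self _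

/-- **The kernel bound**: `|∑_{m<M} e(y m)| ≤ 1 / (2 min(fract y, 1 − fract y))` when `fract y ≠ 0`. [cite: Shor1997, §5] -/
theorem norm_kernel_le (M : ℕ) {y : ℝ} (hy : Int.fract y ≠ 0) :
    ‖∑ m ∈ range M, e1 y m‖ ≤ 1 / (2 * min (Int.fract y) (1 - Int.fract y)) := by
  have hf0 : 0 < Int.fract y := lt_of_le_of_ne (Int.fract_nonneg y) (Ne.symm hy)
  have hf1 : Int.fract y < 1 := Int.fract_lt_one y
  have hmin : 0 < min (Int.fract y) (1 - Int.fract y) := lt_min hf0 (by linarith)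
  -- reduce to the fractional part
  have hred : ∑ m ∈ range M, e1 y m = ∑ m ∈ range M, e1 (Int.fract y) m := by
    conv_lhs => rw [← Int.fract_add_floor y]
    exact kernel_add_int M (Int.fract y) ⌊y⌋
  rw [hred]
  set f := Int.fract y with hf
  set z : ℂ := cexp (2 * Real.pi * I * (f : ℂ)) with hz
  have he1 : ∀ m : ℕ, e1 f m = z ^ m := by
    intro m
    unfold e1
    rw [hz, ← Complex.exp_nat_mul]
    congr 1
    push_cast
    ring
  have hz1 : ‖z‖ = 1 := by
    rw [hz, show 2 * (Real.pi : ℂ) * I * (f : ℂ) = ((2 * Real.pi * f : ℝ) : ℂ) * I by push_cast; ring]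
    exact Complex.norm_exp_ofReal_mul_I _
  have hsin : 0 < |Real.sin (Real.pi * f)| :=
    lt_of_lt_of_le (by positivity) (two_mul_min_le_abs_sin hf0.le hf1.le)
  have hnorm : ‖z - 1‖ = 2 * |Real.sin (Real.pi * f)| := by
    rw [hz, show 2 * (Real.pi : ℂ) * I * (f : ℂ) = I * ((2 * Real.pi * f : ℝ) : ℂ) by push_cast; ring,
      Complex.norm_exp_I_mul_ofReal_sub_one, show (2 * Real.pi * f : ℝ) / 2 = Real.pi * f by ring,
      Real.norm_eq_abs, abs_mul, abs_two]
  have hzne : z ≠ 1 := by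
    intro h; have : ‖z - 1‖ = 0 := by rw [h, sub_self, norm_zero]
    rw [hnorm] at this; linarith
  simp_rw [he1]
  rw [geom_sum_eq hzne, norm_div]
  have hnum : ‖z ^ M - 1‖ ≤ 2 := (norm_sub_le _ _).trans (by rw [norm_pow, hz1, one_pow, norm_one]; norm_num)
  rw [hnorm, div_le_div_iff₀ (by positivity) (by positivity)]
  have h2 := two_mul_min_le_abs_sin hf0.le hf1.le
  nlinarith [hnum, h2, hmin]

/-! ### The window tail on the shifted grid -/

/-- **Off-window energy on the shifted grid**: for `u ≥ 3`,
`∑_{ν<M, u ≤ M·min(fract(x+ν/M), 1 − fract(x+ν/M))} |D_M(x + ν/M)|² ≤ M²/(u − 2)`. [cite: Shor1997, §5] -/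
theorem sum_norm_sq_kernel_shift_offWindow (M : ℕ) (hM : 0 < M) (x : ℝ) {u : ℕ} (hu : 3 ≤ u) :
    ∑ ν ∈ (range M).filter (fun ν : ℕ => (u : ℝ) ≤ M * min (Int.fract (x + (ν : ℝ) / M)) (1 - Int.fract (x + (ν : ℝ) / M))),
      ‖∑ m ∈ range M, e1 (x + (ν : ℝ) / M) m‖ ^ 2 ≤ (M : ℝ) ^ 2 / (u - 2) := by
  have hMR : (0 : ℝ) < M := by exact_mod_cast hM
  -- the fractional parts of the grid points: `fract (x + ν/M) = ((s + ν) % M + f₀)/M`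
  set s : ℕ := (⌊(M : ℝ) * x⌋ % (M : ℤ)).toNat with hs
  set f₀ : ℝ := Int.fract ((M : ℝ) * x) with hf₀
  have hf₀0 : 0 ≤ f₀ := Int.fract_nonneg _
  have hf₀1 : f₀ < 1 := Int.fract_lt_one _
  have hsM : s < M := by
    have h1 : 0 ≤ ⌊(M : ℝ) * x⌋ % (M : ℤ) := Int.emod_nonneg _ (by exact_mod_cast hM.ne')
    have h2 : ⌊(M : ℝ) * x⌋ % (M : ℤ) < M := Int.emod_lt_of_pos _ (by exact_mod_cast hM)
    omega
  have hfract : ∀ ν : ℕ, Int.fract (x + (ν : ℝ) / M) = ((((s + ν) % M : ℕ) : ℝ) + f₀) / M := by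
    intro ν
    -- `x + ν/M = (⌊Mx⌋ + ν + f₀)/M` and `⌊Mx⌋ + ν = (s + ν) % M + M q`
    have hfl : ((⌊(M : ℝ) * x⌋ : ℤ) : ℝ) + f₀ = (M : ℝ) * x := by rw [hf₀]; exact Int.floor_add_fract _
    have hx : x + (ν : ℝ) / M = (((⌊(M : ℝ) * x⌋ : ℤ) : ℝ) + ν + f₀) / M := by
      have hfl' : ((⌊x * (M : ℝ)⌋ : ℤ) : ℝ) + f₀ = x * M := by rw [mul_comm]; exact hfl
      field_simp
      linarith
    obtain ⟨q, hq⟩ : ∃ q : ℤ, (⌊(M : ℝ) * x⌋ : ℤ) + ν = (((s + ν) % M : ℕ) : ℤ) + M * q := by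
      refine ⟨(⌊(M : ℝ) * x⌋ + ν) / M, ?_⟩
      have hsz : (s : ℤ) = ⌊(M : ℝ) * x⌋ % (M : ℤ) := by
        rw [hs, Int.toNat_of_nonneg (Int.emod_nonneg _ (by exact_mod_cast hM.ne'))]
      have hmod : (((s + ν) % M : ℕ) : ℤ) = ((⌊(M : ℝ) * x⌋ + ν) % M) := by
        push_cast
        rw [hsz, Int.add_emod, Int.emod_emod_of_dvd _ (dvd_refl _), ← Int.add_emod]
      rw [hmod]
      exact (Int.emod_add_mul_ediv _ _).symm
    have hqR : ((⌊(M : ℝ) * x⌋ : ℤ) : ℝ) + ν = (((s + ν) % M : ℕ) : ℝ) + M * q := by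
      have := congrArg (fun z : ℤ => (z : ℝ)) hq
      push_cast at this
      exact this
    rw [hx, show (((⌊(M : ℝ) * x⌋ : ℤ) : ℝ) + ν + f₀) / M = ((((s + ν) % M : ℕ) : ℝ) + f₀) / M + (q : ℝ) by
      field_simp; linarith]
    rw [Int.fract_add_intCast, Int.fract_eq_self.2]
    constructor
    · positivity
    · rw [div_lt_one hMR]
      have h1 : (((s + ν) % M : ℕ) : ℝ) + 1 ≤ M := by exact_mod_cast (show (s + ν) % M + 1 ≤ M from Nat.mod_lt _ hM)
      linarith
  -- everything is a function of `r = (s + ν) % M`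
  set G : ℕ → ℝ := fun r => if (u : ℝ) ≤ M * min (((r : ℝ) + f₀) / M) (1 - ((r : ℝ) + f₀) / M) then
      ‖∑ m ∈ range M, e1 ((((r : ℝ) + f₀) / M)) m‖ ^ 2 else 0 with hG
  have hker : ∀ ν : ℕ, ∑ m ∈ range M, e1 (x + (ν : ℝ) / M) m = ∑ m ∈ range M, e1 ((((((s + ν) % M : ℕ) : ℝ)) + f₀) / M) m := by
    intro ν
    conv_lhs => rw [← Int.fract_add_floor (x + (ν : ℝ) / M)]
    rw [kernel_add_int, hfract]
  have hLHS : (∑ ν ∈ (range M).filter (fun ν : ℕ => (u : ℝ) ≤ M * min (Int.fract (x + (ν : ℝ) / M)) (1 - Int.fract (x + (ν : ℝ) / M))),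
      ‖∑ m ∈ range M, e1 (x + (ν : ℝ) / M) m‖ ^ 2) = ∑ ν ∈ range M, G ((s + ν) % M) := by
    rw [sum_filter]
    refine sum_congr rfl fun ν _ => ?_
    simp only [hG, hfract ν, hker ν]
  rw [hLHS, sum_range_shift hM s G]
  -- pointwise bound: off-window forces `u ≤ r`, `u ≤ M − r`, and the kernel is `≤ M/(2 min(r, M−1−r))`
  set T' := (range M).filter (fun r => u - 1 ≤ r ∧ u - 1 ≤ M - 1 - r) with hT'
  have hpt : ∀ r ∈ range M, G r ≤ (M : ℝ) ^ 2 / 4 *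
      (if u - 1 ≤ r ∧ u - 1 ≤ M - 1 - r then 1 / (r : ℝ) ^ 2 + 1 / ((M - 1 - r : ℕ) : ℝ) ^ 2 else 0) := by
    intro r hr
    have hrM : r < M := mem_range.1 hr
    simp only [hG]
    by_cases hwin : (u : ℝ) ≤ M * min (((r : ℝ) + f₀) / M) (1 - ((r : ℝ) + f₀) / M)
    · rw [if_pos hwin]
      rw [mul_min_of_nonneg _ _ hMR.le, le_min_iff] at hwin
      obtain ⟨hw1, hw2⟩ := hwin
      have hw1' : (u : ℝ) ≤ r + f₀ := by
        have : (M : ℝ) * (((r : ℝ) + f₀) / M) = r + f₀ := by field_simp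
        linarith
      have hw2' : (u : ℝ) ≤ M - (r + f₀) := by
        have : (M : ℝ) * (1 - ((r : ℝ) + f₀) / M) = M - (r + f₀) := by field_simp
        linarith
      have hur : u ≤ r := by
        have : (u : ℝ) < r + 1 := by linarith
        exact_mod_cast (by exact_mod_cast this : (u : ℝ) < ((r + 1 : ℕ) : ℝ)) |> fun h => Nat.lt_succ_iff.1 (by exact_mod_cast h)
      have huMr : u ≤ M - r := by
        have h1 : (u : ℝ) ≤ (M : ℝ) - r := by linarith
        have h2 : ((M - r : ℕ) : ℝ) = (M : ℝ) - r := by rw [Nat.cast_sub hrM.le]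
        exact_mod_cast (show (u : ℝ) ≤ ((M - r : ℕ) : ℝ) by rw [h2]; exact h1)
      have hcond : u - 1 ≤ r ∧ u - 1 ≤ M - 1 - r := ⟨by omega, by omega⟩
      rw [if_pos hcond]
      -- the kernel bound at `y = (r + f₀)/M`, `fract y = y`
      have hy0 : 0 ≤ ((r : ℝ) + f₀) / M := by positivity
      have hy1 : ((r : ℝ) + f₀) / M < 1 := by
        rw [div_lt_one hMR]
        have : (r : ℝ) ≤ M - 1 := by
          have : ((r : ℕ) : ℝ) + 1 ≤ M := by exact_mod_cast (show r + 1 ≤ M by omega)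
          linarith
        linarith
      have hfr : Int.fract (((r : ℝ) + f₀) / M) = ((r : ℝ) + f₀) / M := Int.fract_eq_self.2 ⟨hy0, hy1⟩
      have hmpos : (0 : ℝ) < ((min r (M - 1 - r) : ℕ) : ℝ) := by
        have : 0 < min r (M - 1 - r) := lt_min (by omega) (by omega)
        exact_mod_cast this
      have hmin_ge : ((min r (M - 1 - r) : ℕ) : ℝ) / M ≤
          min (Int.fract (((r : ℝ) + f₀) / M)) (1 - Int.fract (((r : ℝ) + f₀) / M)) := by
        rw [hfr, le_min_iff]
        constructor
        · rw [div_le_div_iff_of_pos_right hMR]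
          calc ((min r (M - 1 - r) : ℕ) : ℝ) ≤ r := by exact_mod_cast min_le_left _ _
            _ ≤ r + f₀ := by linarith
        · rw [show (1 : ℝ) - ((r : ℝ) + f₀) / M = ((M : ℝ) - (r + f₀)) / M by field_simp,
            div_le_div_iff_of_pos_right hMR]
          have h1 : ((min r (M - 1 - r) : ℕ) : ℝ) ≤ ((M - 1 - r : ℕ) : ℝ) := by exact_mod_cast min_le_right _ _
          have h2 : ((M - 1 - r : ℕ) : ℝ) = (M : ℝ) - 1 - r := by
            rw [Nat.cast_sub (by omega), Nat.cast_sub (by omega)]; push_cast; ring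
          linarith
      have hfrne : Int.fract (((r : ℝ) + f₀) / M) ≠ 0 := by
        rw [hfr]
        have : (0 : ℝ) < r := by exact_mod_cast (show 0 < r by omega)
        positivity
      have hk := norm_kernel_le M hfrne
      have hminpos : 0 < min (Int.fract (((r : ℝ) + f₀) / M)) (1 - Int.fract (((r : ℝ) + f₀) / M)) :=
        lt_of_lt_of_le (by positivity) hmin_ge
      have hk' : ‖∑ m ∈ range M, e1 (((r : ℝ) + f₀) / M) m‖ ≤ (M : ℝ) / (2 * ((min r (M - 1 - r) : ℕ) : ℝ)) := by
        refine hk.trans ?_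
        rw [div_le_div_iff₀ (by positivity) (by positivity)]
        have := mul_le_mul_of_nonneg_left hmin_ge (show (0 : ℝ) ≤ 2 * M by positivity)
        calc 1 * (2 * ((min r (M - 1 - r) : ℕ) : ℝ)) = 2 * M * (((min r (M - 1 - r) : ℕ) : ℝ) / M) := by
              field_simp
          _ ≤ 2 * M * min (Int.fract (((r : ℝ) + f₀) / M)) (1 - Int.fract (((r : ℝ) + f₀) / M)) := this
          _ = (M : ℝ) * (2 * min (Int.fract (((r : ℝ) + f₀) / M)) (1 - Int.fract (((r : ℝ) + f₀) / M))) := by ring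
      have hsq : ‖∑ m ∈ range M, e1 (((r : ℝ) + f₀) / M) m‖ ^ 2 ≤
          (M : ℝ) ^ 2 / (4 * ((min r (M - 1 - r) : ℕ) : ℝ) ^ 2) := by
        calc _ ≤ ((M : ℝ) / (2 * ((min r (M - 1 - r) : ℕ) : ℝ))) ^ 2 := pow_le_pow_left₀ (norm_nonneg _) hk' 2
          _ = _ := by rw [div_pow]; ring
      have hmin_inv : (1 : ℝ) / ((min r (M - 1 - r) : ℕ) : ℝ) ^ 2 ≤ 1 / (r : ℝ) ^ 2 + 1 / ((M - 1 - r : ℕ) : ℝ) ^ 2 := by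
        rcases le_total r (M - 1 - r) with h | h
        · rw [min_eq_left h]
          have : (0 : ℝ) ≤ 1 / ((M - 1 - r : ℕ) : ℝ) ^ 2 := by positivity
          linarith
        · rw [min_eq_right h]
          have : (0 : ℝ) ≤ 1 / (r : ℝ) ^ 2 := by positivity
          linarith
      calc _ ≤ (M : ℝ) ^ 2 / (4 * ((min r (M - 1 - r) : ℕ) : ℝ) ^ 2) := hsq
        _ = (M : ℝ) ^ 2 / 4 * (1 / ((min r (M - 1 - r) : ℕ) : ℝ) ^ 2) := by ring
        _ ≤ (M : ℝ) ^ 2 / 4 * (1 / (r : ℝ) ^ 2 + 1 / ((M - 1 - r : ℕ) : ℝ) ^ 2) := by gcongr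
    · rw [if_neg hwin]
      positivity
  -- `∑_{u−2 < k ≤ N} 1/k² ≤ 1/(u−2)`
  have hIoc : ∀ N : ℕ, ∑ k ∈ Ioc (u - 2) N, (1 : ℝ) / (k : ℝ) ^ 2 ≤ 1 / ((u - 2 : ℕ) : ℝ) := by
    have hK₀ : 1 ≤ u - 2 := by omega
    have key : ∀ N : ℕ, u - 2 ≤ N → ∑ k ∈ Ioc (u - 2) N, (1 : ℝ) / (k : ℝ) ^ 2 ≤ 1 / ((u - 2 : ℕ) : ℝ) - 1 / N := by
      intro N hN
      induction N, hN using Nat.le_induction with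
      | base => simp
      | succ N hKN ih =>
        rw [sum_Ioc_succ_top hKN]
        have hN : (0 : ℝ) < N := by exact_mod_cast (lt_of_lt_of_le hK₀ hKN)
        have step : (1 : ℝ) / ((N + 1 : ℕ) : ℝ) ^ 2 ≤ 1 / N - 1 / ((N + 1 : ℕ) : ℝ) := by
          push_cast
          rw [div_sub_div _ _ hN.ne' (by positivity), div_le_div_iff₀ (by positivity) (by positivity)]
          nlinarith
        linarith
    intro N
    rcases le_or_gt (u - 2) N with h | h
    · exact (key N h).trans (sub_le_self _ (by positivity))
    · rw [Ioc_eq_empty (by omega), sum_empty]; positivity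
  have hsum1 : ∑ r ∈ T', (1 : ℝ) / (r : ℝ) ^ 2 ≤ 1 / ((u - 2 : ℕ) : ℝ) := by
    calc ∑ r ∈ T', (1 : ℝ) / (r : ℝ) ^ 2 ≤ ∑ r ∈ Ioc (u - 2) M, (1 : ℝ) / (r : ℝ) ^ 2 := by
          apply sum_le_sum_of_subset_of_nonneg
          · intro r hr
            have h := mem_filter.1 hr
            exact mem_Ioc.2 ⟨by omega, (mem_range.1 h.1).le⟩
          · intro k _ _; positivity
      _ ≤ _ := hIoc M
  have hsum2 : ∑ r ∈ T', (1 : ℝ) / ((M - 1 - r : ℕ) : ℝ) ^ 2 = ∑ r ∈ T', (1 : ℝ) / (r : ℝ) ^ 2 := by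
    refine sum_nbij' (fun r => M - 1 - r) (fun r => M - 1 - r) ?_ ?_ ?_ ?_ ?_
    · intro r hr
      have h := mem_filter.1 hr
      have hrM := mem_range.1 h.1
      exact mem_filter.2 ⟨mem_range.2 (by omega), by omega, by omega⟩
    · intro r hr
      have h := mem_filter.1 hr
      have hrM := mem_range.1 h.1
      exact mem_filter.2 ⟨mem_range.2 (by omega), by omega, by omega⟩
    · intro r hr
      have hrM := mem_range.1 (mem_filter.1 hr).1
      show M - 1 - (M - 1 - r) = r
      omega
    · intro r hr
      have hrM := mem_range.1 (mem_filter.1 hr).1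
      show M - 1 - (M - 1 - r) = r
      omega
    · intro r hr
      rfl
  have hu2 : (0 : ℝ) < ((u - 2 : ℕ) : ℝ) := by exact_mod_cast (show 0 < u - 2 by omega)
  have hu2' : ((u - 2 : ℕ) : ℝ) = (u : ℝ) - 2 := by rw [Nat.cast_sub (by omega)]; norm_num
  calc ∑ r ∈ range M, G r
      ≤ ∑ r ∈ range M, (M : ℝ) ^ 2 / 4 *
          (if u - 1 ≤ r ∧ u - 1 ≤ M - 1 - r then 1 / (r : ℝ) ^ 2 + 1 / ((M - 1 - r : ℕ) : ℝ) ^ 2 else 0) :=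
        sum_le_sum hpt
    _ = (M : ℝ) ^ 2 / 4 * ∑ r ∈ T', (1 / (r : ℝ) ^ 2 + 1 / ((M - 1 - r : ℕ) : ℝ) ^ 2) := by
        rw [← mul_sum, hT', sum_filter]
    _ = (M : ℝ) ^ 2 / 4 * (2 * ∑ r ∈ T', (1 : ℝ) / (r : ℝ) ^ 2) := by rw [sum_add_distrib, hsum2]; ring
    _ ≤ (M : ℝ) ^ 2 / 4 * (2 * (1 / ((u - 2 : ℕ) : ℝ))) := by gcongr
    _ = (M : ℝ) ^ 2 / (2 * ((u - 2 : ℕ) : ℝ)) := by field_simp; ring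
    _ ≤ (M : ℝ) ^ 2 / ((u - 2 : ℕ) : ℝ) := div_le_div_of_nonneg_left (by positivity) hu2 (by linarith)
    _ = (M : ℝ) ^ 2 / ((u : ℝ) - 2) := by rw [hu2']

end PeriodFinding

end Literature.Computability.Cryptography
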